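import Literature.Probability.LatticeModels.ReflectedCurrents
import Literature.Probability.LatticeModels.FieldCurrents
import HarnessLib

/-!
# Duminil-Copin–Panis 2025, Lemma 2.5: the random-current bound behind Theorem 1.2
# (domain Markov property of reflected currents, conditioning on the cluster, outer switching)

Topic `Literature/Probability/LatticeModels`; family `crit-ising`. Layer of the tree's proof of the named fact
`Literature.Probability.LatticeModels.dcp_reflectedGradient_lower` (Duminil-Copin–Panis, CMP 406 (2025),
arXiv:2404.05700, Theorem 1.2 at `β_c`; `CriticalTwoPointDCPLower.lean`), on top of `ReflectedCurrents.lean`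
(fold data `IsFoldable G θ Λ H₋`, folded current `fold`, `ConnFix` = "`x ↔_{ℳ_n} ℍ_n`", the switching lemma
for reflected currents = Lemma 2.3, the handshake `connFix_fold_of_sources`) and of the cut/factorisation tools
of `FieldCurrents.lean` (`crestr`, `tsum_eq_tsum_prod_of_csupp_union`, `csources_crestr_inner/outer`). It proves,
for an ABSTRACT fold datum (so that it applies on the even tori of `CriticalTwoPointDCPLowerTorus.lean`),

**Lemma 2.5** (source, p. 10 of arXiv v1): "For `β ≤ β_c`,
`𝐄^∅_β[𝟙_{0 ∈ 𝒮¹_n} ∑_{x ∈ 𝒮¹_n, y ∼ x, y ∈ Λ_n} 𝟙_{y ↔^{ℳ_n} ℍ_n} ⟨σ₀σ_x⟩_{𝒮¹_n,β}] ≤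
∑_{x,y ∈ Λ_n, y ∼ x} (⟨σ₀σ_x⟩_β - ⟨σ₀σ_{𝓡_n(x)}⟩_β) ⟨σ_yσ_{𝓡_n(y)}⟩_β`",
in its printed per-pair, finite-volume, un-normalised form (`IsFoldable.lemma25`): for `β ≥ 0`, a candidate
region `B ⊆ Λ` inside `H₋ ∪ Fix`, `o, x ∈ B ∩ H₋`, `y ∈ Λ ∩ (H₋ ∪ Fix)` and `W(n) = {v ∈ B : v ↮_{ℳ_n} ℍ}` (`𝒮¹_n`),
`∑_{∂n=∅} w_β(n) 𝟙[o,x ∈ W(n), y ↔ ℍ] ⟨σ_oσ_x⟩^∅_{W(n)} ≤ (Z^{{o,x}} - Z^{{o,θx}}) ⟨σ_yσ_{θy}⟩^∅_Λ`.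

## The printed proof and its formal counterpart

1. **Griffiths** (`𝒮¹_n ⊆ 𝒢_n`): `⟨σ_oσ_x⟩_{W(n)} ≤ ⟨σ_oσ_x⟩_{𝒢_n}` where
   `𝒢_n = {v ∈ Λ : v, θv ↮ ℍ}` (`IsFoldable.gset`; `mem_gset_iff_not_connFix`, `twoPoint_volume_mono`).
2. **Domain Markov on `𝒢_n`**: "`Z^∅_Λ[𝒢_n = S] = Z^∅_S Z^∅_{Λ∖S}[𝒢_n = S]` and
   `Z^{{0,x}}_S Z^∅_{Λ∖S}[𝒢_n = S] = Z^{{0,x}}_Λ[𝒢_n = S]`", hence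
   `∑_S 𝐄^∅[𝟙_{𝒢_n = S} ⟨σ₀σ_x⟩_S] = Z^{{0,x}}[0,x ∈ 𝒢_n, y ∉ 𝒢_n]/Z^∅` — `IsFoldable.gset_eq_iff` (the event
   `𝒢_n = S` is "no charge across `(S, Λ∖S)`" times an event of the outer part: `csupp_cut_of_foldClosed`,
   `cconn_fold_transfer`), `tsum_cut_factor` (the bijection `n ↦ (n^{ℰ_S}, n^{ℰ_{Λ∖S}})`),
   `currentZ_edgesIn_pair_eq` (`Z_S^{{o,x}} = ⟨σ_oσ_x⟩_S Z_S^∅`), assembled in `gset_markov` and `tsum_gset_markov`.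
3. **Conditioning on `𝒞_n(0)`** (cluster of `0` in `ℳ_n` union its reflection, `IsFoldable.cset`):
   `Z^{{0,x}}[𝒞_n(0) = S, y ↔ ℍ] = Z^{{0,x}}[𝒞_n(0) = S] · Z^∅_{Λ∖S}[y ↔ ℍ]/Z^∅_{Λ∖S}` — `cset_eq_iff`,
   `connFix_iff_connFix_crestr`, `tsum_cut_factor` (`tsum_cset_connFix_le`).
4. **Outer switching and Griffiths**: `Z^∅_{Λ∖S}[y ↔ ℍ] = Z^{{y,θy}}_{Λ∖S} ≤ ⟨σ_yσ_{θy}⟩_Λ Z^∅_{Λ∖S}`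
   (Lemma 2.3 on the symmetric support `ℰ_{Λ∖S}`; `tsum_outer_connFix_le`).
5. **Un-conditioning**: `∑_S Z^{{0,x}}[𝒞_n(0) = S] = Z^{{0,x}}[0,x ↮ ℍ] = Z^{{0,x}} - Z^{{0,𝓡x}}`
   (Lemma 2.3 at `x` and the handshake for `θ^*n`: `tsum_not_connFix_add_currentZ`,
   `cconn_fold_of_csources_pair`; `tsum_pair_event_le`).

Also: the fold geometry (`mem_or_fixed_of_isLeft`, right points are isolated in the fold:
`eq_of_cconn_fold_of_right`, `not_connFix_theta`). No named fact; definitions with bodies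
(`IsFoldable.Symm`, `IsFoldable.FoldClosed`, `IsFoldable.gset`, `IsFoldable.cset`) only.

## References

* H. Duminil-Copin, R. Panis, *New lower bounds for the (near) critical Ising and φ⁴ models’ two-point
  functions*, Comm. Math. Phys. 406 (2025), arXiv:2404.05700, §2.2, Lemma 2.5 and its proof (eqs. (2.21)–(2.23))
  [DuminilCopinPanis2025LowerBounds] (held: `lit read arxiv:2404.05700`, chunks 10–11).
* H. Duminil-Copin, V. Tassion, CMP 343 (2016), arXiv:1502.03050, proof of Lemma 2.6 (the random-set
  conditioning template) [DuminilCopinTassionCMP2016] — through `FieldCurrents.lean`.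
* H. Duminil-Copin, arXiv:1607.06933, §2.2.1 [DuminilCopinECM2018]; S. Friedli, Y. Velenik, CUP 2017,
  Exercise 3.12, Thm. 3.20 [FriedliVelenik2017] — random-current dictionary and Griffiths.
-/

noncomputable section

open Finset
open scoped symmDiff ENNReal

namespace Literature.Probability.LatticeModels

namespace IsFoldable

variable {V : Type*} [DecidableEq V] {G : SimpleGraph V} [G.LocallyFinite] {θ : V ≃ V} {Λ Hm : Finset V}
variable (h : IsFoldable G θ Λ Hm)
include h

/-! ### Geometry of the folded current -/

/-- The folded current lives on left edges. [folklore] -/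
theorem isLeft_of_fold_ne_zero {n : edgesIn G Λ → ℕ} {e : edgesIn G Λ} (he : h.fold n e ≠ 0) :
    IsLeft Hm (e : Sym2 V) := by
  unfold IsFoldable.fold at he
  by_contra hl
  exact he (if_neg hl)

/-- `fold n e > 0` iff `e` is a left edge carrying `n`-charge itself or through its reflection. [folklore] -/
theorem fold_pos_iff' {n : edgesIn G Λ → ℕ} {e : edgesIn G Λ} :
    0 < h.fold n e ↔ IsLeft Hm (e : Sym2 V) ∧ (0 < n e ∨ 0 < n (h.edgeRefl e)) := by
  unfold IsFoldable.fold
  split_ifs with hl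
  · simp [hl]
  · simp [hl]

/-- **Endpoints of left edges are in `H₋` or fixed.** [cite: DuminilCopinPanis2025LowerBounds, §2.2 (the sets E₋, E₊, E₀)] -/
theorem mem_or_fixed_of_isLeft {e : Sym2 V} (he : e ∈ edgesIn G Λ) (hl : IsLeft Hm e) {v : V} (hv : v ∈ e) :
    v ∈ Hm ∨ θ v = v := by
  by_contra hcon
  push Not at hcon
  have hvΛ : v ∈ Λ := (mem_edgesIn_iff.1 he).2 v hv
  have hθv : θ v ∈ Hm := (h.cover v hvΛ hcon.2).resolve_left hcon.1
  obtain ⟨a, ha, hae⟩ := hl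
  have he' : e ∈ G.edgeSet := (mem_edgesIn_iff.1 he).1
  revert he' hae hv
  induction e using Sym2.ind with
  | _ p q =>
    intro hv hae he'
    have hadj : G.Adj p q := (SimpleGraph.mem_edgeSet G).1 he'
    rcases Sym2.mem_iff.1 hae with rfl | rfl <;> rcases Sym2.mem_iff.1 hv with rfl | rfl
    · exact hcon.1 ha
    · exact h.no_cross _ ha _ hadj hθv
    · exact h.no_cross _ ha _ hadj.symm hθv
    · exact hcon.1 ha

/-- **A step of the folded current starts in `H₋ ∪ Fix`.** [folklore] -/
theorem mem_or_fixed_of_fold_step {m n : edgesIn G Λ → ℕ} (hm : m = h.fold n) {u v : V}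
    (huv : ∃ e : edgesIn G Λ, (e : Sym2 V) ∈ edgesIn G Λ ∧ 0 < m e ∧ (e : Sym2 V) = s(u, v)) :
    (u ∈ Hm ∨ θ u = u) ∧ (v ∈ Hm ∨ θ v = v) := by
  obtain ⟨e, he, hpos, hes⟩ := huv
  subst hm
  have hl : IsLeft Hm (e : Sym2 V) := h.isLeft_of_fold_ne_zero hpos.ne'
  exact ⟨h.mem_or_fixed_of_isLeft he hl (hes ▸ Sym2.mem_mk_left u v),
    h.mem_or_fixed_of_isLeft he hl (hes ▸ Sym2.mem_mk_right u v)⟩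

/-- **Right points are isolated in the folded current**: a vertex with `θ u ∈ H₋` is fold-connected only
to itself. [folklore] -/
theorem eq_of_cconn_fold_of_right {n : edgesIn G Λ → ℕ} {E' : Finset (Sym2 V)} {u v : V} (hu : θ u ∈ Hm)
    (hc : CConn G Λ (h.fold n) E' u v) : v = u := by
  induction hc with
  | refl => rfl
  | tail _ hbc ih =>
    exfalso
    obtain ⟨e, _, hpos, hes⟩ := hbc
    have hb := (h.mem_or_fixed_of_fold_step rfl ⟨e, e.2, hpos, hes⟩).1
    rw [ih] at hb
    rcases hb with hmem | hfix
    · exact h.left_disjoint u hmem hu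
    · rw [hfix] at hu
      exact h.not_mem_of_fixed hfix hu

/-- Right points are not connected to the hyperplane in the fold. [folklore] -/
theorem not_connFix_of_right {n : edgesIn G Λ → ℕ} {u : V} (hu : θ u ∈ Hm) : ¬ h.ConnFix (h.fold n) u := by
  rintro ⟨f, _, hff, hc⟩
  have hfu := h.eq_of_cconn_fold_of_right hu hc
  rw [hfu] at hff
  rw [hff] at hu
  exact h.not_mem_of_fixed hff hu

/-- Reflections of left points are not connected to the hyperplane in the fold. [folklore] -/
theorem not_connFix_theta {n : edgesIn G Λ → ℕ} {u : V} (hu : u ∈ Hm) : ¬ h.ConnFix (h.fold n) (θ u) :=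
  h.not_connFix_of_right (by rwa [h.invol u])

/-- Fixed points of `Λ` are connected to the hyperplane (empty path). [folklore] -/
theorem connFix_of_fixed (m : edgesIn G Λ → ℕ) {f : V} (hf : f ∈ Λ) (hff : θ f = f) : h.ConnFix m f :=
  ⟨f, hf, hff, Relation.ReflTransGen.refl⟩

/-- `ConnFix` is monotone in the current. [folklore] -/
theorem connFix_mono {m m' : edgesIn G Λ → ℕ} (hle : ∀ e, m e ≤ m' e) {u : V} (hc : h.ConnFix m u) :
    h.ConnFix m' u := by
  obtain ⟨f, hf, hff, hc⟩ := hc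
  exact ⟨f, hf, hff, CConn.mono hle hc⟩

/-- Fold-connected vertices have the same `ConnFix` status. [folklore] -/
theorem connFix_iff_of_cconn {m : edgesIn G Λ → ℕ} {u v : V} (hc : CConn G Λ m (edgesIn G Λ) u v) :
    h.ConnFix m u ↔ h.ConnFix m v := by
  constructor
  · rintro ⟨f, hf, hff, hcf⟩
    exact ⟨f, hf, hff, hc.symm.trans hcf⟩
  · rintro ⟨f, hf, hff, hcf⟩
    exact ⟨f, hf, hff, hc.trans hcf⟩

/-! ### Symmetric sets, closed cuts and paths of the folded current -/

/-- A vertex set is `θ`-symmetric. [folklore] -/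
def Symm (_h : IsFoldable G θ Λ Hm) (T : Finset V) : Prop := ∀ v, v ∈ T ↔ θ v ∈ T

/-- A vertex set is closed under the charged edges of the folded current of `n`. [folklore] -/
def FoldClosed (h : IsFoldable G θ Λ Hm) (n : edgesIn G Λ → ℕ) (T : Finset V) : Prop :=
  ∀ e : edgesIn G Λ, 0 < h.fold n e → ∀ u v : V, (e : Sym2 V) = s(u, v) → (u ∈ T ↔ v ∈ T)

omit [G.LocallyFinite] in
/-- The complement in `Λ` of a symmetric set is symmetric. [folklore] -/
theorem symm_sdiff {T : Finset V} (hT : h.Symm T) : h.Symm (Λ \ T) := fun v => by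
  rw [mem_sdiff, mem_sdiff, ← hT v, h.mem_iff v]

/-- Edges inside a symmetric set are mapped to edges inside it. [folklore] -/
theorem map_mem_edgesIn_of_symm {T : Finset V} (hT : h.Symm T) {e : Sym2 V} (he : e ∈ edgesIn G T) :
    Sym2.map θ e ∈ edgesIn G T := by
  rw [mem_edgesIn_iff] at he ⊢
  refine ⟨?_, fun v hv => ?_⟩
  · revert he
    induction e using Sym2.ind with
    | _ a b =>
      intro he
      rw [Sym2.map_mk, SimpleGraph.mem_edgeSet]
      exact (h.adj_iff a b).2 ((SimpleGraph.mem_edgeSet G).1 he.1)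
  · rw [h.mem_map_iff] at hv
    have := he.2 _ hv
    rwa [← hT] at this

/-- The folded current is monotone. [folklore] -/
theorem fold_mono {m m' : edgesIn G Λ → ℕ} (hle : m ≤ m') : h.fold m ≤ h.fold m' := by
  intro e
  unfold IsFoldable.fold
  split_ifs
  · exact Nat.add_le_add (hle e) (hle _)
  · exact le_rfl

/-- **Closed cuts from fold-closed symmetric sets**: if `S ⊆ Λ` is `θ`-symmetric, contains no fixed
vertex, and every charged edge of the folded current has both or none of its endpoints in `S`, then
`n` has no charged edge across the cut `(S, Λ ∖ S)` (the identities "`Z_Λ[𝒢_n = S] = Z_S · Z_{Λ∖S}[…]`" of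
Duminil-Copin–Panis 2025, proof of Lemma 2.5, rest on this). [cite: DuminilCopinPanis2025LowerBounds, Lemma 2.5 (proof)] -/
theorem csupp_cut_of_foldClosed {n : edgesIn G Λ → ℕ} {S : Finset V} (hsymm : h.Symm S)
    (hnofix : ∀ v ∈ S, θ v ≠ v) (hclosed : h.FoldClosed n S) :
    CSupp G Λ (edgesIn G S ∪ edgesIn G (Λ \ S)) n := by
  intro e hne
  obtain ⟨e, heΛ⟩ := e
  have hpos : 0 < n ⟨e, heΛ⟩ := Nat.pos_of_ne_zero hne
  induction e using Sym2.ind with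
  | _ a b =>
    obtain ⟨hadj, hmem⟩ := mem_edgesIn_iff.1 heΛ
    have ha : a ∈ Λ := hmem a (Sym2.mem_mk_left a b)
    have hb : b ∈ Λ := hmem b (Sym2.mem_mk_right a b)
    -- both endpoints on the same side
    have key : a ∈ S ↔ b ∈ S := by
      rcases h.isLeft_or heΛ with hl | hr | hfix
      · exact hclosed ⟨_, heΛ⟩ (lt_of_lt_of_le hpos (by
          unfold IsFoldable.fold; rw [if_pos hl]; exact Nat.le_add_right _ _)) a b rfl
      · have he' : Sym2.map θ s(a, b) ∈ edgesIn G Λ := h.map_mem_edgesIn heΛ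
        have hfold : 0 < h.fold n ⟨Sym2.map θ s(a, b), he'⟩ := by
          unfold IsFoldable.fold
          rw [if_pos hr]
          have : h.edgeRefl ⟨Sym2.map θ s(a, b), he'⟩ = ⟨s(a, b), heΛ⟩ := Subtype.ext (h.map_map s(a, b))
          rw [this]
          exact lt_of_lt_of_le hpos (Nat.le_add_left _ _)
        have h1 := hclosed ⟨_, he'⟩ hfold (θ a) (θ b) (by show Sym2.map θ s(a, b) = s(θ a, θ b); rw [Sym2.map_mk])
        rw [← hsymm a, ← hsymm b] at h1
        exact h1
      · constructor
        · intro haS; exact absurd (hfix a (Sym2.mem_mk_left a b)) (hnofix a haS)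
        · intro hbS; exact absurd (hfix b (Sym2.mem_mk_right a b)) (hnofix b hbS)
    by_cases haS : a ∈ S
    · refine mem_union_left _ (mem_edgesIn_iff.2 ⟨hadj, fun v hv => ?_⟩)
      rcases Sym2.mem_iff.1 hv with rfl | rfl
      · exact haS
      · exact key.1 haS
    · refine mem_union_right _ (mem_edgesIn_iff.2 ⟨hadj, fun v hv => ?_⟩)
      rcases Sym2.mem_iff.1 hv with rfl | rfl
      · exact mem_sdiff.2 ⟨ha, haS⟩
      · exact mem_sdiff.2 ⟨hb, fun hbS => haS (key.2 hbS)⟩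

/-- **Paths of the folded current stay inside a symmetric part with closed cut**, and are paths of
the folded current of the restriction: for `T ⊆ Λ` symmetric with no charged edge of `n` across
`(T, Λ ∖ T)`, and `w ∈ T`, `w ↔ v` in `fold n` forces `v ∈ T` and `w ↔ v` in `fold (n^{ℰ_T})`
(cf. `cconn_iff_cconn_outer`). [cite: DuminilCopinPanis2025LowerBounds, Lemma 2.5 (proof)] -/
theorem cconn_fold_transfer {n : edgesIn G Λ → ℕ} {T : Finset V} (hsymm : h.Symm T)
    (hcut : CSupp G Λ (edgesIn G T ∪ edgesIn G (Λ \ T)) n) {w v : V} (hw : w ∈ T)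
    (hc : CConn G Λ (h.fold n) (edgesIn G Λ) w v) :
    v ∈ T ∧ CConn G Λ (h.fold (crestr G Λ (edgesIn G T) n)) (edgesIn G Λ) w v := by
  induction hc with
  | refl => exact ⟨hw, Relation.ReflTransGen.refl⟩
  | @tail c c' _ hcc' ih =>
    obtain ⟨hc, hconn⟩ := ih
    obtain ⟨e, heE, hpos, hes⟩ := hcc'
    obtain ⟨hl, hor⟩ := h.fold_pos_iff'.1 hpos
    -- `e` and its reflection lie inside `T`
    have hboth : (e : Sym2 V) ∈ edgesIn G T ∧ ((h.edgeRefl e : edgesIn G Λ) : Sym2 V) ∈ edgesIn G T := by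
      rcases hor with h1 | h2
      · have hmem : (e : Sym2 V) ∈ edgesIn G T := by
          rcases mem_union.1 (hcut e h1.ne') with hT | hout
          · exact hT
          · exact absurd ((mem_edgesIn_iff.1 hout).2 c (hes ▸ Sym2.mem_mk_left c c')) (fun hc' => (mem_sdiff.1 hc').2 hc)
        exact ⟨hmem, h.map_mem_edgesIn_of_symm hsymm hmem⟩
      · have hmem : ((h.edgeRefl e : edgesIn G Λ) : Sym2 V) ∈ edgesIn G T := by
          rcases mem_union.1 (hcut _ h2.ne') with hT | hout
          · exact hT
          · have hθc : θ c ∈ Sym2.map θ (e : Sym2 V) := (h.mem_map_iff _ _).2 (by rw [h.invol c, hes]; exact Sym2.mem_mk_left c c')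
            exact absurd ((mem_edgesIn_iff.1 hout).2 (θ c) hθc) (fun hc' => (mem_sdiff.1 hc').2 ((hsymm c).1 hc))
        refine ⟨?_, hmem⟩
        have := h.map_mem_edgesIn_of_symm hsymm hmem
        rwa [h.coe_edgeRefl, h.map_map] at this
    have hc'T : c' ∈ T := (mem_edgesIn_iff.1 hboth.1).2 c' (hes ▸ Sym2.mem_mk_right c c')
    refine ⟨hc'T, hconn.tail ⟨e, heE, ?_, hes⟩⟩
    -- the fold of the restriction agrees with the fold on `e`
    have heq : h.fold (crestr G Λ (edgesIn G T) n) e = h.fold n e := by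
      unfold IsFoldable.fold
      rw [if_pos hl, if_pos hl, crestr_apply_of_mem n hboth.1, crestr_apply_of_mem n hboth.2]
    rw [heq]
    exact hpos

/-- **`ConnFix` only depends on the part of the current inside a symmetric set with closed cut.** [cite: DuminilCopinPanis2025LowerBounds, Lemma 2.5 (proof)] -/
theorem connFix_iff_connFix_crestr {n : edgesIn G Λ → ℕ} {T : Finset V} (hsymm : h.Symm T)
    (hcut : CSupp G Λ (edgesIn G T ∪ edgesIn G (Λ \ T)) n) {w : V} (hw : w ∈ T) :
    h.ConnFix (h.fold n) w ↔ h.ConnFix (h.fold (crestr G Λ (edgesIn G T) n)) w := by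
  constructor
  · rintro ⟨f, hf, hff, hc⟩
    exact ⟨f, hf, hff, (h.cconn_fold_transfer hsymm hcut hw hc).2⟩
  · exact h.connFix_mono (h.fold_mono (crestr_le _ n))

/-! ### The random sets `𝒢_n` and `𝒞_n(o)` -/

open Classical in
/-- **`𝒢_n`** (Duminil-Copin–Panis 2025, proof of Lemma 2.5: "`𝒢_n := {x ∈ Λ : x or 𝓡_n(x) ↮^{ℳ_n} ℍ_n}`",
in the symmetric reading the proof uses): the vertices `v ∈ Λ` such that neither `v` nor `θ v` is
connected to the hyperplane in the folded current. [cite: DuminilCopinPanis2025LowerBounds, Lemma 2.5 (proof, the set 𝒢_n)] -/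
def gset (n : edgesIn G Λ → ℕ) : Finset V :=
  Λ.filter fun v => ¬ h.ConnFix (h.fold n) v ∧ ¬ h.ConnFix (h.fold n) (θ v)

open Classical in
/-- **`𝒞_n(o)`** (Duminil-Copin–Panis 2025, proof of Lemma 2.5: "the set `𝒞_n(0)` defined as the union
of the cluster of `0` in `ℳ_n` and its reflection with respect to `ℍ_n`"), within `Λ`. [cite: DuminilCopinPanis2025LowerBounds, Lemma 2.5 (proof, the set 𝒞_n(0))] -/
def cset (n : edgesIn G Λ → ℕ) (o : V) : Finset V :=
  Λ.filter fun v => CConn G Λ (h.fold n) (edgesIn G Λ) o v ∨ CConn G Λ (h.fold n) (edgesIn G Λ) o (θ v)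

open Classical in
/-- Membership in `𝒢_n`. [folklore] -/
theorem mem_gset {n : edgesIn G Λ → ℕ} {v : V} :
    v ∈ h.gset n ↔ v ∈ Λ ∧ ¬ h.ConnFix (h.fold n) v ∧ ¬ h.ConnFix (h.fold n) (θ v) := by
  unfold gset; rw [mem_filter]

open Classical in
/-- Membership in `𝒞_n(o)`. [folklore] -/
theorem mem_cset {n : edgesIn G Λ → ℕ} {o v : V} :
    v ∈ h.cset n o ↔ v ∈ Λ ∧ (CConn G Λ (h.fold n) (edgesIn G Λ) o v ∨ CConn G Λ (h.fold n) (edgesIn G Λ) o (θ v)) := by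
  unfold cset; rw [mem_filter]

/-- `𝒢_n ⊆ Λ`. [folklore] -/
theorem gset_subset (n : edgesIn G Λ → ℕ) : h.gset n ⊆ Λ := fun _ hv => (h.mem_gset.1 hv).1

/-- `𝒞_n(o) ⊆ Λ`. [folklore] -/
theorem cset_subset (n : edgesIn G Λ → ℕ) (o : V) : h.cset n o ⊆ Λ := fun _ hv => (h.mem_cset.1 hv).1

/-- `𝒢_n` is symmetric. [folklore] -/
theorem symm_gset (n : edgesIn G Λ → ℕ) : h.Symm (h.gset n) := fun v => by
  rw [h.mem_gset, h.mem_gset, h.invol v, ← h.mem_iff v]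
  tauto

/-- `𝒞_n(o)` is symmetric. [folklore] -/
theorem symm_cset (n : edgesIn G Λ → ℕ) (o : V) : h.Symm (h.cset n o) := fun v => by
  rw [h.mem_cset, h.mem_cset, h.invol v, ← h.mem_iff v]
  tauto

/-- `𝒢_n` contains no fixed vertex. [folklore] -/
theorem nofix_of_mem_gset {n : edgesIn G Λ → ℕ} {v : V} (hv : v ∈ h.gset n) : θ v ≠ v := fun hff =>
  (h.mem_gset.1 hv).2.1 (h.connFix_of_fixed _ (h.mem_gset.1 hv).1 hff)

/-- **`𝒢_n` on `H₋ ∪ Fix`**: for such `v ∈ Λ`, `v ∈ 𝒢_n ↔ v ↮ ℍ`. [folklore] -/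
theorem mem_gset_iff_not_connFix {n : edgesIn G Λ → ℕ} {v : V} (hvΛ : v ∈ Λ) (hv : v ∈ Hm ∨ θ v = v) :
    v ∈ h.gset n ↔ ¬ h.ConnFix (h.fold n) v := by
  rw [h.mem_gset]
  rcases hv with hv | hv
  · exact ⟨fun h' => h'.2.1, fun h' => ⟨hvΛ, h', h.not_connFix_theta hv⟩⟩
  · rw [hv]
    exact ⟨fun h' => h'.2.1, fun h' => ⟨hvΛ, h', h'⟩⟩

/-- **`𝒞_n(o)` on `H₋ ∪ Fix`** (`o ∈ H₋`): for such `v ∈ Λ`, `v ∈ 𝒞_n(o) ↔ o ↔ v` in the fold. [folklore] -/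
theorem mem_cset_iff_cconn {n : edgesIn G Λ → ℕ} {o v : V} (ho : o ∈ Hm) (hvΛ : v ∈ Λ) (hv : v ∈ Hm ∨ θ v = v) :
    v ∈ h.cset n o ↔ CConn G Λ (h.fold n) (edgesIn G Λ) o v := by
  rw [h.mem_cset]
  rcases hv with hv | hv
  · refine ⟨fun h' => h'.2.elim id fun hc => ?_, fun h' => ⟨hvΛ, Or.inl h'⟩⟩
    have := h.eq_of_cconn_fold_of_right (show θ (θ v) ∈ Hm by rwa [h.invol v]) hc.symm
    exact absurd (this ▸ ho) (h.left_disjoint v hv)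
  · rw [hv]
    exact ⟨fun h' => h'.2.elim id id, fun h' => ⟨hvΛ, Or.inl h'⟩⟩

/-- `𝒢_n` is closed under the charged edges of the folded current. [folklore] -/
theorem foldClosed_gset (n : edgesIn G Λ → ℕ) : h.FoldClosed n (h.gset n) := by
  intro e hpos u v hes
  have hl := h.isLeft_of_fold_ne_zero hpos.ne'
  have huΛ : u ∈ Λ := (mem_edgesIn_iff.1 e.2).2 u (hes ▸ Sym2.mem_mk_left u v)
  have hvΛ : v ∈ Λ := (mem_edgesIn_iff.1 e.2).2 v (hes ▸ Sym2.mem_mk_right u v)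
  have hu := h.mem_or_fixed_of_isLeft e.2 hl (hes ▸ Sym2.mem_mk_left u v)
  have hv := h.mem_or_fixed_of_isLeft e.2 hl (hes ▸ Sym2.mem_mk_right u v)
  rw [h.mem_gset_iff_not_connFix huΛ hu, h.mem_gset_iff_not_connFix hvΛ hv,
    h.connFix_iff_of_cconn (Relation.ReflTransGen.single ⟨e, e.2, hpos, hes⟩)]

/-- `𝒞_n(o)` (`o ∈ H₋`) is closed under the charged edges of the folded current. [folklore] -/
theorem foldClosed_cset (n : edgesIn G Λ → ℕ) {o : V} (ho : o ∈ Hm) : h.FoldClosed n (h.cset n o) := by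
  intro e hpos u v hes
  have hl := h.isLeft_of_fold_ne_zero hpos.ne'
  have huΛ : u ∈ Λ := (mem_edgesIn_iff.1 e.2).2 u (hes ▸ Sym2.mem_mk_left u v)
  have hvΛ : v ∈ Λ := (mem_edgesIn_iff.1 e.2).2 v (hes ▸ Sym2.mem_mk_right u v)
  have hu := h.mem_or_fixed_of_isLeft e.2 hl (hes ▸ Sym2.mem_mk_left u v)
  have hv := h.mem_or_fixed_of_isLeft e.2 hl (hes ▸ Sym2.mem_mk_right u v)
  rw [h.mem_cset_iff_cconn ho huΛ hu, h.mem_cset_iff_cconn ho hvΛ hv]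
  exact CConn.edge_iff e.2 hpos hes o

/-- `o ∈ 𝒞_n(o)` for `o ∈ Λ`. [folklore] -/
theorem mem_cset_self (n : edgesIn G Λ → ℕ) {o : V} (ho : o ∈ Λ) : o ∈ h.cset n o :=
  h.mem_cset.2 ⟨ho, Or.inl Relation.ReflTransGen.refl⟩

/-- If `o ↮ ℍ`, then `𝒞_n(o)` contains no fixed vertex. [folklore] -/
theorem nofix_of_mem_cset {n : edgesIn G Λ → ℕ} {o : V} (hno : ¬ h.ConnFix (h.fold n) o) {v : V}
    (hv : v ∈ h.cset n o) : θ v ≠ v := by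
  intro hff
  obtain ⟨hvΛ, hc | hc⟩ := h.mem_cset.1 hv
  · exact hno ⟨v, hvΛ, hff, hc⟩
  · rw [hff] at hc
    exact hno ⟨v, hvΛ, hff, hc⟩

/-! ### Characterisation of `𝒢_n = S` and `𝒞_n(o) = S` across the cut -/

omit h in
/-- The cut of `Λ ∖ S` is the cut of `S`. [folklore] -/
theorem csupp_cut_comm {n : edgesIn G Λ → ℕ} {S : Finset V} (hS : S ⊆ Λ)
    (hcut : CSupp G Λ (edgesIn G S ∪ edgesIn G (Λ \ S)) n) :
    CSupp G Λ (edgesIn G (Λ \ S) ∪ edgesIn G (Λ \ (Λ \ S))) n := by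
  rw [Finset.sdiff_sdiff_eq_self hS, union_comm]
  exact hcut

/-- **`𝒢_n = S` across the cut** (the domain Markov step "`Z^∅_{Λ,β}[𝒢_n = S] = Z^∅_{S,β} Z^∅_{Λ∖S,β}[𝒢_n = S]`"
of the proof of Lemma 2.5): for `S ⊆ Λ` symmetric without fixed vertices, `𝒢_n = S` iff `n` has no
charged edge across `(S, Λ ∖ S)` and, in the folded current of the outer part `n^{ℰ_{Λ∖S}}`, every vertex
of `Λ ∖ S` or its reflection is connected to the hyperplane — an event of the outer part alone. [cite: DuminilCopinPanis2025LowerBounds, Lemma 2.5 (proof, the identity for Z[𝒢_n = S])] -/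
theorem gset_eq_iff {n : edgesIn G Λ → ℕ} {S : Finset V} (hS : S ⊆ Λ) (hsymm : h.Symm S)
    (hnofix : ∀ v ∈ S, θ v ≠ v) :
    h.gset n = S ↔ CSupp G Λ (edgesIn G S ∪ edgesIn G (Λ \ S)) n ∧
      ∀ v ∈ Λ \ S, h.ConnFix (h.fold (crestr G Λ (edgesIn G (Λ \ S)) n)) v ∨
        h.ConnFix (h.fold (crestr G Λ (edgesIn G (Λ \ S)) n)) (θ v) := by
  have hsymm' : h.Symm (Λ \ S) := h.symm_sdiff hsymm
  constructor
  · intro hG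
    have hcut : CSupp G Λ (edgesIn G S ∪ edgesIn G (Λ \ S)) n := by
      rw [← hG]
      exact h.csupp_cut_of_foldClosed (h.symm_gset n) (fun v hv => h.nofix_of_mem_gset hv) (h.foldClosed_gset n)
    refine ⟨hcut, fun v hv => ?_⟩
    have hcut' := csupp_cut_comm hS hcut
    have hvG : v ∉ h.gset n := by rw [hG]; exact (mem_sdiff.1 hv).2
    rw [h.mem_gset] at hvG
    push Not at hvG
    by_cases hc : h.ConnFix (h.fold n) v
    · exact Or.inl ((h.connFix_iff_connFix_crestr hsymm' hcut' hv).1 hc)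
    · have hθv : θ v ∈ Λ \ S := (hsymm' v).1 hv
      exact Or.inr ((h.connFix_iff_connFix_crestr hsymm' hcut' hθv).1 (hvG (mem_sdiff.1 hv).1 hc))
  · rintro ⟨hcut, hall⟩
    have hle : h.fold (crestr G Λ (edgesIn G (Λ \ S)) n) ≤ h.fold n := h.fold_mono (crestr_le _ n)
    ext v
    constructor
    · intro hv
      by_contra hvS
      have hvK : v ∈ Λ \ S := mem_sdiff.2 ⟨(h.mem_gset.1 hv).1, hvS⟩
      rcases hall v hvK with hc | hc
      · exact (h.mem_gset.1 hv).2.1 (h.connFix_mono hle hc)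
      · exact (h.mem_gset.1 hv).2.2 (h.connFix_mono hle hc)
    · intro hvS
      have hin : ∀ w ∈ S, ¬ h.ConnFix (h.fold n) w := by
        rintro w hw ⟨f, hf, hff, hc⟩
        have hfS : f ∈ S := (h.cconn_fold_transfer hsymm hcut hw hc).1
        exact hnofix f hfS hff
      exact h.mem_gset.2 ⟨hS hvS, hin v hvS, hin (θ v) ((hsymm v).1 hvS)⟩

/-- With a closed cut and `o ∈ S`, the (symmetrised) cluster of `o` is that of the inner part. [folklore] -/
theorem cset_crestr_eq {n : edgesIn G Λ → ℕ} {S : Finset V} (hsymm : h.Symm S)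
    (hcut : CSupp G Λ (edgesIn G S ∪ edgesIn G (Λ \ S)) n) {o : V} (hoS : o ∈ S) :
    h.cset (crestr G Λ (edgesIn G S) n) o = h.cset n o := by
  have hle : h.fold (crestr G Λ (edgesIn G S) n) ≤ h.fold n := h.fold_mono (crestr_le _ n)
  ext v
  rw [h.mem_cset, h.mem_cset]
  constructor
  · rintro ⟨hv, hc | hc⟩
    · exact ⟨hv, Or.inl (CConn.mono hle hc)⟩
    · exact ⟨hv, Or.inr (CConn.mono hle hc)⟩
  · rintro ⟨hv, hc | hc⟩
    · exact ⟨hv, Or.inl (h.cconn_fold_transfer hsymm hcut hoS hc).2⟩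
    · exact ⟨hv, Or.inr (h.cconn_fold_transfer hsymm hcut hoS hc).2⟩

/-- **`𝒞_n(o) = S` across the cut**: for `S ⊆ Λ` symmetric without fixed vertices and `o ∈ S ∩ H₋`,
`𝒞_n(o) = S` iff the cut `(S, Λ ∖ S)` is closed and the cluster of `o` of the inner part `n^{ℰ_S}` is
`S` — the factorisation "`Z^{{0,x}}[𝒞_n(0) = S, y ↔ ℍ_n] = Z^{{0,x}}[𝒞_n(0) = S] · Z^∅_{Λ∖S}[y ↔ ℍ_n]/Z^∅_{Λ∖S}`"
of the proof of Lemma 2.5. [cite: DuminilCopinPanis2025LowerBounds, Lemma 2.5 (proof, eq. (2.23))] -/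
theorem cset_eq_iff {n : edgesIn G Λ → ℕ} {o : V} (ho : o ∈ Hm) {S : Finset V} (hsymm : h.Symm S)
    (hnofix : ∀ v ∈ S, θ v ≠ v) (hoS : o ∈ S) :
    h.cset n o = S ↔ CSupp G Λ (edgesIn G S ∪ edgesIn G (Λ \ S)) n ∧ h.cset (crestr G Λ (edgesIn G S) n) o = S := by
  constructor
  · intro hC
    have hcut : CSupp G Λ (edgesIn G S ∪ edgesIn G (Λ \ S)) n := by
      rw [← hC]
      refine h.csupp_cut_of_foldClosed (h.symm_cset n o) (fun v hv => hnofix v (hC ▸ hv)) (h.foldClosed_cset n ho)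
    exact ⟨hcut, (h.cset_crestr_eq hsymm hcut hoS).trans hC⟩
  · rintro ⟨hcut, hC⟩
    rw [← h.cset_crestr_eq hsymm hcut hoS, hC]

/-- If `𝒞_n(o)` has no fixed vertex then `o ↮ ℍ`. [folklore] -/
theorem not_connFix_of_cset_nofix {n : edgesIn G Λ → ℕ} {o : V}
    (hnofix : ∀ v ∈ h.cset n o, θ v ≠ v) : ¬ h.ConnFix (h.fold n) o := by
  rintro ⟨f, hf, hff, hc⟩
  exact hnofix f (h.mem_cset.2 ⟨hf, Or.inl hc⟩) hff

/-! ### Factorisation of current sums across a closed cut -/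

omit h in
/-- Sources of a current with no charge across `(S, Λ ∖ S)`, `A ⊆ S`: `∂n = A` iff `∂(n^{ℰ_S}) = A` and
`∂(n^{ℰ_{Λ∖S}}) = ∅`. [folklore] -/
theorem csources_eq_iff_crestr {n : edgesIn G Λ → ℕ} {S A : Finset V} (hA : A ⊆ S)
    (hs : CSupp G Λ (edgesIn G S ∪ edgesIn G (Λ \ S)) n) :
    csources G Λ n = A ↔ csources G Λ (crestr G Λ (edgesIn G S) n) = A ∧
      csources G Λ (crestr G Λ (edgesIn G (Λ \ S)) n) = ∅ := by
  rw [csources_crestr_inner hs, csources_crestr_outer hs]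
  constructor
  · intro hn
    rw [hn]
    refine ⟨filter_true_of_mem fun v hv => hA hv, ?_⟩
    rw [filter_eq_empty_iff]
    exact fun v hv hvS => hvS (hA hv)
  · rintro ⟨h1, h2⟩
    rw [← filter_union_filter_not_eq (· ∈ S) (csources G Λ n), h1, h2, union_empty]

omit h in
/-- **Factorisation across a closed cut** (the bijection `n ↦ (n^{ℰ_S}, n^{ℰ_{Λ∖S}})`; weights multiply,
sources split): for `A ⊆ S ⊆ Λ` and functions `F₁`, `F₂` of the two parts,
`∑_{∂n = A} w(n) 𝟙[no charge across (S, Λ∖S)] F₁(n^{ℰ_S}) F₂(n^{ℰ_{Λ∖S}}) = (∑_{n₁ ⊆ ℰ_S, ∂n₁ = A} w F₁)(∑_{n₂ ⊆ ℰ_{Λ∖S}, ∂n₂ = ∅} w F₂)`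
("`Z^∅_{Λ,β}[𝒢_n = S] = Z^∅_{S,β} Z^∅_{Λ∖S,β}[𝒢_n = S]` and `Z^{{0,x}}_{S,β} Z^∅_{Λ∖S,β}[𝒢_n = S] = Z^{{0,x}}_{Λ,β}[𝒢_n = S]`",
Duminil-Copin–Panis 2025, proof of Lemma 2.5). [cite: DuminilCopinPanis2025LowerBounds, Lemma 2.5 (proof, domain Markov identities)] -/
theorem tsum_cut_factor (β : ℝ) {S A : Finset V} (hA : A ⊆ S)
    (F₁ F₂ : (edgesIn G Λ → ℕ) → ℝ≥0∞) :
    ∑' n, ind (csources G Λ n = A ∧ CSupp G Λ (edgesIn G Λ) n) * cweight G Λ β n *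
        (ind (CSupp G Λ (edgesIn G S ∪ edgesIn G (Λ \ S)) n) *
          (F₁ (crestr G Λ (edgesIn G S) n) * F₂ (crestr G Λ (edgesIn G (Λ \ S)) n))) =
      (∑' n₁, ind (csources G Λ n₁ = A ∧ CSupp G Λ (edgesIn G S) n₁) * cweight G Λ β n₁ * F₁ n₁) *
        ∑' n₂, ind (csources G Λ n₂ = ∅ ∧ CSupp G Λ (edgesIn G (Λ \ S)) n₂) * cweight G Λ β n₂ * F₂ n₂ := by
  have hdisj : Disjoint (edgesIn G S) (edgesIn G (Λ \ S)) := disjoint_edgesIn_sdiff S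
  set Ψ : (edgesIn G Λ → ℕ) → (edgesIn G Λ → ℕ) → ℝ≥0∞ := fun n₁ n₂ =>
    (ind (csources G Λ n₁ = A) * cweight G Λ β n₁ * F₁ n₁) * (ind (csources G Λ n₂ = ∅) * cweight G Λ β n₂ * F₂ n₂) with hΨ
  have hre : ∀ n, ind (csources G Λ n = A ∧ CSupp G Λ (edgesIn G Λ) n) * cweight G Λ β n *
      (ind (CSupp G Λ (edgesIn G S ∪ edgesIn G (Λ \ S)) n) *
        (F₁ (crestr G Λ (edgesIn G S) n) * F₂ (crestr G Λ (edgesIn G (Λ \ S)) n))) =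
      ind (CSupp G Λ (edgesIn G S ∪ edgesIn G (Λ \ S)) n) *
        Ψ (crestr G Λ (edgesIn G S) n) (crestr G Λ (edgesIn G (Λ \ S)) n) := by
    intro n
    by_cases hs : CSupp G Λ (edgesIn G S ∪ edgesIn G (Λ \ S)) n
    · rw [ind_of_true hs, one_mul, one_mul, hΨ]
      simp only
      have hw : cweight G Λ β n = cweight G Λ β (crestr G Λ (edgesIn G S) n) * cweight G Λ β (crestr G Λ (edgesIn G (Λ \ S)) n) :=
        gweight_eq_mul_of_csupp_union (fun _ => β) hdisj hs
      rw [ind_congr (and_iff_left (csupp_edgesIn n)), ind_congr (csources_eq_iff_crestr hA hs), ind_and, hw]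
      ring
    · rw [ind_of_false hs]; simp
  simp_rw [hre]
  rw [tsum_eq_tsum_prod_of_csupp_union G Λ hdisj Ψ, tsum_mul_tsum_eq_tsum_prod]
  refine tsum_congr fun p => ?_
  rw [hΨ]
  simp only
  rw [ind_and (CSupp G Λ (edgesIn G S) p.1), ind_and (csources G Λ p.1 = A), ind_and (csources G Λ p.2 = ∅)]
  ring

omit h in
/-- **The random-current representation in a sub-volume**: for `a, b ∈ S ⊆ Λ` and `β ≥ 0`,
`Z_{ℰ_S}({a} ∆ {b}) = ⟨σ_aσ_b⟩^∅_{S;β,0} · Z_{ℰ_S}(∅)` (Duminil-Copin 2016, §2.2.1 with Remark 3.4). [cite: DuminilCopinECM2018, §2.2.1 (high-temperature expansion)] -/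
theorem currentZ_edgesIn_pair_eq {β : ℝ} (hβ : 0 ≤ β) {S : Finset V} (hS : S ⊆ Λ) {a b : V} (ha : a ∈ S) (hb : b ∈ S) :
    currentZ G Λ β (edgesIn G S) ({a} ∆ {b}) =
      ENNReal.ofReal (isingTwoPoint G S β 0 .free a b) * currentZ G Λ β (edgesIn G S) ∅ := by
  have hcosh : 0 < Real.cosh β ^ #(edgesIn G S) := pow_pos (Real.cosh_pos β) _
  have hg0 : 0 < hteSum G S (Real.tanh β) ∅ := hteSum_empty_pos G S β
  have hgnn : 0 ≤ hteSum G S (Real.tanh β) ({a} ∆ {b}) := hteSum_nonneg G S (tanh_nonneg hβ) _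
  rw [currentZ_edgesIn_eq G Λ hβ hS, currentZ_edgesIn_eq G Λ hβ hS, isingTwoPoint_free_eq_hteSum_div G S β ha hb,
    ← ENNReal.ofReal_mul (div_nonneg hgnn hg0.le)]
  congr 1
  field_simp

/-! ### Clusters of currents with sources `{o, x}` -/

/-- **`x` lies in the cluster of `o`** when `∂n = {o} ∆ {x}` (`o, x ∈ H₋`) and `o ↮ ℍ`: the cluster of `o`
in `𝒩₋` contains another odd vertex, which is `x` or a vertex of the hyperplane (Duminil-Copin–Panis 2025,
proof of Lemma 2.5: "`Z^{{0,x}}[0, x ↮ ℍ_n] = …`", `{0 ↮ ℍ} = {x ↮ ℍ}`). [cite: DuminilCopinPanis2025LowerBounds, Lemma 2.5 (proof)] -/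
theorem cconn_fold_of_csources_pair {n : edgesIn G Λ → ℕ} {o x : V} (ho : o ∈ Hm) (hx : x ∈ Hm)
    (hn : csources G Λ n = {o} ∆ {x}) (hno : ¬ h.ConnFix (h.fold n) o) :
    CConn G Λ (h.fold n) (edgesIn G Λ) o x := by
  classical
  by_cases hox : o = x
  · subst hox; exact Relation.ReflTransGen.refl
  set m : edgesIn G Λ → ℕ := crestrict h.leftEdges n with hm
  have hoΛ : o ∈ Λ := h.left_subset ho
  have hosrc : o ∈ csources G Λ n := by
    rw [hn, mem_symmDiff, mem_singleton, mem_singleton]; exact Or.inl ⟨rfl, hox⟩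
  have hoodd : Odd (cdeg G Λ m o) := by
    rw [hm, h.cdeg_crestrict_left_of_mem n ho]
    exact (mem_filter.1 hosrc).2
  obtain ⟨v, hvΛ, hvo, hvodd, hvconn⟩ := exists_odd_cconn m hoΛ hoodd
  have hle : ∀ e, m e ≤ h.fold n e := h.crestrict_left_le_fold n
  by_cases hvm : v ∈ Hm
  · rw [hm, h.cdeg_crestrict_left_of_mem n hvm] at hvodd
    have hvsrc : v ∈ csources G Λ n := mem_filter.2 ⟨hvΛ, hvodd⟩
    rw [hn, mem_symmDiff, mem_singleton, mem_singleton] at hvsrc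
    rcases hvsrc with ⟨rfl, -⟩ | ⟨rfl, -⟩
    · exact absurd rfl hvo
    · exact CConn.mono hle hvconn
  · by_cases hfix : θ v = v
    · exact absurd ⟨v, hvΛ, hfix, CConn.mono hle hvconn⟩ hno
    · have hvr := (h.cover v hvΛ hfix).resolve_left hvm
      rw [hm, h.cdeg_crestrict_left_of_mem_right n hvr] at hvodd
      exact absurd hvodd Nat.not_odd_zero

/-- Under `∂n = {o} ∆ {x}` (`o, x ∈ H₋`): `o ↮ ℍ` implies `x ↮ ℍ`. [cite: DuminilCopinPanis2025LowerBounds, Lemma 2.5 (proof)] -/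
theorem not_connFix_x_of_not_connFix_o {n : edgesIn G Λ → ℕ} {o x : V} (ho : o ∈ Hm) (hx : x ∈ Hm)
    (hn : csources G Λ n = {o} ∆ {x}) (hno : ¬ h.ConnFix (h.fold n) o) : ¬ h.ConnFix (h.fold n) x := fun hcx =>
  hno ((h.connFix_iff_of_cconn (h.cconn_fold_of_csources_pair ho hx hn hno)).2 hcx)

/-- The folded current of `θ^* n` is the folded current of `n`. [folklore] -/
theorem fold_creflect' (n : edgesIn G Λ → ℕ) : h.fold (h.creflect n) = h.fold n := by
  funext e
  unfold IsFoldable.fold IsFoldable.creflect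
  split_ifs
  · rw [h.edgeRefl_edgeRefl, add_comm]
  · rfl

/-- **Currents with sources `{o, θx}` connect `x` to the hyperplane** (`o, x ∈ H₋`; handshake for
the reflected current `θ^*n`, whose only source in `H₋` is `x`). [cite: DuminilCopinPanis2025LowerBounds, Lemma 2.5 (proof, Z^{{0,𝓡x}}[x ↔ ℍ] = Z^{{0,𝓡x}})] -/
theorem connFix_of_csources_theta {n : edgesIn G Λ → ℕ} {o x : V} (ho : o ∈ Hm) (hx : x ∈ Hm)
    (hn : csources G Λ n = {o} ∆ {θ x}) : h.ConnFix (h.fold n) x := by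
  classical
  have hθo : θ o ∉ Hm := h.left_disjoint o ho
  have hxθo : x ≠ θ o := fun hxo => hθo (hxo ▸ hx)
  rw [← h.fold_creflect' n]
  refine h.connFix_fold_of_sources (h.creflect n) hx fun v hv => ?_
  rw [h.csources_creflect, hn, image_symmDiff _ _ θ.injective, image_singleton, image_singleton, h.invol x,
    mem_symmDiff, mem_singleton, mem_singleton]
  constructor
  · rintro (⟨rfl, -⟩ | ⟨rfl, -⟩)
    · exact absurd hv hθo
    · rfl
  · rintro rfl
    exact Or.inr ⟨rfl, hxθo⟩

/-- **`Z^{{o,x}}[x ↮ ℍ] + Z^{{o,θx}} = Z^{{o,x}}`** (`o, x ∈ H₋`, any symmetric support `E'`): by Lemma 2.3 at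
`x`, `Z^{{o,x}}[x ↔ ℍ] = Z^{{o,θx}}[x ↔ ℍ] = Z^{{o,θx}}` (Duminil-Copin–Panis 2025, proof of Lemma 2.5, eq. (2.22)
summed: "`Z^{{0,x}}[0,x ↮ ℍ_n] = Z^{{0,x}} - Z^{{0,𝓡_n(x)}}`"). [cite: DuminilCopinPanis2025LowerBounds, Lemma 2.5 (proof, eq. (2.22))] -/
theorem tsum_not_connFix_add_currentZ {β : ℝ} (hβ : 0 ≤ β) {E' : Finset (Sym2 V)}
    (hE' : ∀ e ∈ edgesIn G Λ, e ∈ E' ↔ Sym2.map θ e ∈ E') {o x : V} (ho : o ∈ Hm) (hx : x ∈ Hm) :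
    ∑' n, ind (csources G Λ n = {o} ∆ {x} ∧ CSupp G Λ E' n) * cweight G Λ β n * ind (¬ h.ConnFix (h.fold n) x) +
        currentZ G Λ β E' ({o} ∆ {θ x}) = currentZ G Λ β E' ({o} ∆ {x}) := by
  classical
  have hset : ({o} : Finset V) ∆ {θ x} = ({o} ∆ {x}) ∆ ({x} ∆ {θ x}) := by
    rw [symmDiff_assoc, symmDiff_symmDiff_cancel_left]
  have hZθ : currentZ G Λ β E' ({o} ∆ {θ x}) =
      ∑' n, ind (csources G Λ n = {o} ∆ {x} ∧ CSupp G Λ E' n) * cweight G Λ β n * ind (h.ConnFix (h.fold n) x) := by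
    rw [h.tsum_switch_reflected_eq ({o} ∆ {x}) hE' hx hβ, ← hset]
    unfold currentZ
    refine tsum_congr fun n => ?_
    by_cases hn : csources G Λ n = {o} ∆ {θ x} ∧ CSupp G Λ E' n
    · rw [ind_of_true (h.connFix_of_csources_theta ho hx hn.1), mul_one]
    · rw [ind_of_false hn, zero_mul, zero_mul]
  rw [hZθ, ← ENNReal.tsum_add]
  unfold currentZ
  refine tsum_congr fun n => ?_
  rw [← mul_add]
  by_cases hc : h.ConnFix (h.fold n) x
  · rw [ind_of_true hc, ind_of_false (not_not.2 hc), zero_add, mul_one]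
  · rw [ind_of_false hc, ind_of_true hc, add_zero, mul_one]

/-! ### Lemma 2.5: the Markov step on `𝒢_n` -/

/-- **`⟨σ_oσ_x⟩_S · Z^∅[𝒢_n = S] = Z^{{o,x}}[𝒢_n = S]`** for `S ⊆ Λ` symmetric without fixed vertices and
`o, x ∈ S` (Duminil-Copin–Panis 2025, proof of Lemma 2.5, the two displayed identities after (2.21)). [cite: DuminilCopinPanis2025LowerBounds, Lemma 2.5 (proof, domain Markov identities)] -/
theorem gset_markov {β : ℝ} (hβ : 0 ≤ β) {S : Finset V} (hS : S ⊆ Λ) (hsymm : h.Symm S)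
    (hnofix : ∀ v ∈ S, θ v ≠ v) {o x : V} (hoS : o ∈ S) (hxS : x ∈ S) :
    ENNReal.ofReal (isingTwoPoint G S β 0 .free o x) *
        ∑' n, ind (csources G Λ n = ∅ ∧ CSupp G Λ (edgesIn G Λ) n) * cweight G Λ β n * ind (h.gset n = S) =
      ∑' n, ind (csources G Λ n = {o} ∆ {x} ∧ CSupp G Λ (edgesIn G Λ) n) * cweight G Λ β n * ind (h.gset n = S) := by
  classical
  -- the outer event
  set Outer : (edgesIn G Λ → ℕ) → Prop := fun m => ∀ v ∈ Λ \ S, h.ConnFix (h.fold m) v ∨ h.ConnFix (h.fold m) (θ v) with hOuter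
  have hchar : ∀ n, ind (h.gset n = S) =
      ind (CSupp G Λ (edgesIn G S ∪ edgesIn G (Λ \ S)) n) * ((fun _ => (1 : ℝ≥0∞)) (crestr G Λ (edgesIn G S) n) *
        ind (Outer (crestr G Λ (edgesIn G (Λ \ S)) n))) := by
    intro n
    rw [one_mul, ← ind_and]
    exact ind_congr (h.gset_eq_iff hS hsymm hnofix)
  have hA : ∀ A : Finset V, A ⊆ S →
      ∑' n, ind (csources G Λ n = A ∧ CSupp G Λ (edgesIn G Λ) n) * cweight G Λ β n * ind (h.gset n = S) =
        currentZ G Λ β (edgesIn G S) A *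
          ∑' n₂, ind (csources G Λ n₂ = ∅ ∧ CSupp G Λ (edgesIn G (Λ \ S)) n₂) * cweight G Λ β n₂ * ind (Outer n₂) := by
    intro A hAS
    simp_rw [hchar]
    rw [tsum_cut_factor β hAS (fun _ => (1 : ℝ≥0∞)) (fun m => ind (Outer m))]
    unfold currentZ
    simp only [mul_one]
  rw [hA ∅ (empty_subset _), hA ({o} ∆ {x}) (fun v hv => by
      rw [mem_symmDiff, mem_singleton, mem_singleton] at hv
      rcases hv with ⟨rfl, -⟩ | ⟨rfl, -⟩ <;> assumption),
    ← mul_assoc, ← currentZ_edgesIn_pair_eq hβ hS hoS hxS]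

/-- **Decomposition according to the value of `𝒢_n`**: `∑_n w 𝟙[Q(𝒢_n)] g(𝒢_n) = ∑_{S ⊆ Λ} 𝟙[Q S] g(S) ∑_n w 𝟙[𝒢_n = S]`. [folklore] -/
theorem tsum_gset_decompose (β : ℝ) (A : Finset V) (Q : Finset V → Prop) (g : Finset V → ℝ≥0∞) :
    ∑' n, ind (csources G Λ n = A ∧ CSupp G Λ (edgesIn G Λ) n) * cweight G Λ β n * (ind (Q (h.gset n)) * g (h.gset n)) =
      ∑ S ∈ Λ.powerset, (ind (Q S) * g S) *
        ∑' n, ind (csources G Λ n = A ∧ CSupp G Λ (edgesIn G Λ) n) * cweight G Λ β n * ind (h.gset n = S) := by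
  classical
  have hpt : ∀ n, ind (Q (h.gset n)) * g (h.gset n) = ∑ S ∈ Λ.powerset, ind (h.gset n = S) * (ind (Q S) * g S) := by
    intro n
    rw [sum_eq_single (h.gset n), ind_of_true rfl, one_mul]
    · intro S _ hS
      rw [ind_of_false (fun h' => hS h'.symm), zero_mul]
    · intro hn
      exact absurd (mem_powerset.2 (h.gset_subset n)) hn
  simp_rw [hpt, mul_sum]
  rw [Summable.tsum_finsetSum (fun _ _ => ENNReal.summable)]
  refine sum_congr rfl fun S _ => ?_
  rw [← ENNReal.tsum_mul_left]
  refine tsum_congr fun n => ?_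
  ring

/-- `𝒢_n` never equals a set that is not symmetric or contains a fixed vertex. [folklore] -/
theorem ind_gset_eq_of_bad {n : edgesIn G Λ → ℕ} {S : Finset V} (hbad : ¬ (h.Symm S ∧ ∀ w ∈ S, θ w ≠ w)) :
    ind (h.gset n = S) = 0 :=
  ind_of_false fun hG => hbad ⟨hG ▸ h.symm_gset n, fun _ hv => h.nofix_of_mem_gset (hG.symm ▸ hv)⟩

/-- **The Markov step of Lemma 2.5** (Duminil-Copin–Panis 2025, proof of Lemma 2.5, from (2.21) to (2.22)):
for `o, x ∈ H₋` and `y ∈ Λ` in `H₋ ∪ Fix`,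
`∑_{∂n=∅} w(n) 𝟙[o,x ↮ ℍ, y ↔ ℍ] ⟨σ_oσ_x⟩_{𝒢_n} = ∑_{∂n={o,x}} w(n) 𝟙[o,x ↮ ℍ, y ↔ ℍ]`
("`∑_{S ∋ 0,x, S ∌ y} Z^{{0,x}}[𝒢_n = S]/Z^∅ = Z^{{0,x}}[0,x ↮ ℍ_n, y ↔ ℍ_n]/Z^∅`"). [cite: DuminilCopinPanis2025LowerBounds, Lemma 2.5 (proof, eqs. (2.21)–(2.22))] -/
theorem tsum_gset_markov {β : ℝ} (hβ : 0 ≤ β) {o x y : V} (ho : o ∈ Hm) (hx : x ∈ Hm) (hy : y ∈ Λ)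
    (hy' : y ∈ Hm ∨ θ y = y) :
    ∑' n, ind (csources G Λ n = ∅ ∧ CSupp G Λ (edgesIn G Λ) n) * cweight G Λ β n *
        (ind (¬ h.ConnFix (h.fold n) o ∧ ¬ h.ConnFix (h.fold n) x ∧ h.ConnFix (h.fold n) y) *
          ENNReal.ofReal (isingTwoPoint G (h.gset n) β 0 .free o x)) =
      ∑' n, ind (csources G Λ n = {o} ∆ {x} ∧ CSupp G Λ (edgesIn G Λ) n) * cweight G Λ β n *
        ind (¬ h.ConnFix (h.fold n) o ∧ ¬ h.ConnFix (h.fold n) x ∧ h.ConnFix (h.fold n) y) := by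
  classical
  have hoΛ : o ∈ Λ := h.left_subset ho
  have hxΛ : x ∈ Λ := h.left_subset hx
  set Q : Finset V → Prop := fun S => o ∈ S ∧ x ∈ S ∧ y ∉ S with hQ
  have hPQ : ∀ n, (¬ h.ConnFix (h.fold n) o ∧ ¬ h.ConnFix (h.fold n) x ∧ h.ConnFix (h.fold n) y) ↔ Q (h.gset n) := by
    intro n
    rw [hQ]
    simp only
    rw [h.mem_gset_iff_not_connFix hoΛ (Or.inl ho), h.mem_gset_iff_not_connFix hxΛ (Or.inl hx),
      h.mem_gset_iff_not_connFix hy hy', not_not]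
  have hL : ∑' n, ind (csources G Λ n = ∅ ∧ CSupp G Λ (edgesIn G Λ) n) * cweight G Λ β n *
      (ind (¬ h.ConnFix (h.fold n) o ∧ ¬ h.ConnFix (h.fold n) x ∧ h.ConnFix (h.fold n) y) *
        ENNReal.ofReal (isingTwoPoint G (h.gset n) β 0 .free o x)) =
      ∑ S ∈ Λ.powerset, (ind (Q S) * ENNReal.ofReal (isingTwoPoint G S β 0 .free o x)) *
        ∑' n, ind (csources G Λ n = ∅ ∧ CSupp G Λ (edgesIn G Λ) n) * cweight G Λ β n * ind (h.gset n = S) := by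
    rw [← h.tsum_gset_decompose β ∅ Q (fun S => ENNReal.ofReal (isingTwoPoint G S β 0 .free o x))]
    refine tsum_congr fun n => ?_
    rw [ind_congr (hPQ n)]
  have hR : ∑' n, ind (csources G Λ n = {o} ∆ {x} ∧ CSupp G Λ (edgesIn G Λ) n) * cweight G Λ β n *
      ind (¬ h.ConnFix (h.fold n) o ∧ ¬ h.ConnFix (h.fold n) x ∧ h.ConnFix (h.fold n) y) =
      ∑ S ∈ Λ.powerset, (ind (Q S) * 1) *
        ∑' n, ind (csources G Λ n = {o} ∆ {x} ∧ CSupp G Λ (edgesIn G Λ) n) * cweight G Λ β n * ind (h.gset n = S) := by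
    rw [← h.tsum_gset_decompose β ({o} ∆ {x}) Q (fun _ => 1)]
    refine tsum_congr fun n => ?_
    rw [ind_congr (hPQ n), mul_one]
  rw [hL, hR]
  refine sum_congr rfl fun S hS => ?_
  rw [mem_powerset] at hS
  by_cases hQS : Q S
  · rw [ind_of_true hQS, one_mul, one_mul, one_mul]
    by_cases hgood : h.Symm S ∧ ∀ v ∈ S, θ v ≠ v
    · exact h.gset_markov hβ hS hgood.1 hgood.2 hQS.1 hQS.2.1
    · have h0 : ∀ A : Finset V, ∑' n, ind (csources G Λ n = A ∧ CSupp G Λ (edgesIn G Λ) n) * cweight G Λ β n *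
          ind (h.gset n = S) = 0 := fun A => ENNReal.tsum_eq_zero.2 fun n => by rw [h.ind_gset_eq_of_bad hgood, mul_zero]
      rw [h0, h0, mul_zero]
  · rw [ind_of_false hQS, zero_mul, zero_mul, zero_mul, zero_mul]

/-! ### Lemma 2.5: conditioning on `𝒞_n(o)` and the outer switching -/

omit h in
/-- Griffiths' volume monotonicity for two-point functions (any locally finite graph, free b.c., `β ≥ 0`). [cite: FriedliVelenik2017, Exercise 3.12, p. 112] -/
theorem twoPoint_volume_mono {β : ℝ} (hβ : 0 ≤ β) {Λ₁ Λ₂ : Finset V} (h12 : Λ₁ ⊆ Λ₂) {a b : V}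
    (ha : a ∈ Λ₁) (hb : b ∈ Λ₁) :
    isingTwoPoint G Λ₁ β 0 .free a b ≤ isingTwoPoint G Λ₂ β 0 .free a b := by
  by_cases hab : a = b
  · subst hab; simp
  rw [isingTwoPoint_eq_isingCorr _ _ _ _ _ hab, isingTwoPoint_eq_isingCorr _ _ _ _ _ hab]
  refine isingCorr_free_le_of_subset G hβ le_rfl ?_ h12
  intro w hw
  simp only [mem_insert, mem_singleton] at hw
  rcases hw with rfl | rfl
  · exact ha
  · exact hb

omit h in
/-- Nonnegativity of two-point functions (GKS I). [cite: FriedliVelenik2017, Theorem 3.20] -/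
theorem twoPoint_nonneg {β : ℝ} (hβ : 0 ≤ β) {Λ₁ : Finset V} {a b : V} (ha : a ∈ Λ₁) (hb : b ∈ Λ₁) :
    0 ≤ isingTwoPoint G Λ₁ β 0 .free a b := by
  by_cases hab : a = b
  · subst hab; simp
  rw [isingTwoPoint_eq_isingCorr _ _ _ _ _ hab]
  refine GKSInequalities.gks_one_holds G hβ le_rfl (Or.inl rfl) ?_
  intro w hw
  simp only [mem_insert, mem_singleton] at hw
  rcases hw with rfl | rfl
  · exact ha
  · exact hb

/-- The edges inside a symmetric set form a `θ`-symmetric support. [folklore] -/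
theorem edgesIn_symm_iff {T : Finset V} (hT : h.Symm T) :
    ∀ e ∈ edgesIn G Λ, e ∈ edgesIn G T ↔ Sym2.map θ e ∈ edgesIn G T := fun e _ =>
  ⟨fun he => h.map_mem_edgesIn_of_symm hT he, fun he => by
    have := h.map_mem_edgesIn_of_symm hT he
    rwa [h.map_map] at this⟩

/-- **The outer switching** (Duminil-Copin–Panis 2025, proof of Lemma 2.5, eq. (2.23) with Lemma 2.3 and
Griffiths): for `K ⊆ Λ` symmetric and `y ∈ K` in `H₋ ∪ Fix`,
`Z^∅_{ℰ_K}[y ↔_ℳ ℍ] ≤ ⟨σ_yσ_{θy}⟩_Λ · Z^∅_{ℰ_K}`. [cite: DuminilCopinPanis2025LowerBounds, Lemma 2.5 (proof, eq. (2.23))] -/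
theorem tsum_outer_connFix_le {β : ℝ} (hβ : 0 ≤ β) {K : Finset V} (hK : K ⊆ Λ) (hsymmK : h.Symm K)
    {y : V} (hyK : y ∈ K) (hy' : y ∈ Hm ∨ θ y = y) :
    ∑' n, ind (csources G Λ n = ∅ ∧ CSupp G Λ (edgesIn G K) n) * cweight G Λ β n * ind (h.ConnFix (h.fold n) y) ≤
      ENNReal.ofReal (isingTwoPoint G Λ β 0 .free y (θ y)) * currentZ G Λ β (edgesIn G K) ∅ := by
  classical
  have hyΛ : y ∈ Λ := hK hyK
  rcases hy' with hym | hfix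
  · have hθyK : θ y ∈ K := (hsymmK y).1 hyK
    calc ∑' n, ind (csources G Λ n = ∅ ∧ CSupp G Λ (edgesIn G K) n) * cweight G Λ β n * ind (h.ConnFix (h.fold n) y)
        = ∑' n, ind (csources G Λ n = ∅ ∆ ({y} ∆ {θ y}) ∧ CSupp G Λ (edgesIn G K) n) * cweight G Λ β n *
            ind (h.ConnFix (h.fold n) y) := h.tsum_switch_reflected_eq ∅ (h.edgesIn_symm_iff hsymmK) hym hβ
      _ ≤ currentZ G Λ β (edgesIn G K) ({y} ∆ {θ y}) := by
          unfold currentZ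
          refine ENNReal.tsum_le_tsum fun n => ?_
          rw [show (∅ : Finset V) ∆ ({y} ∆ {θ y}) = {y} ∆ {θ y} from bot_symmDiff _]
          exact mul_le_of_le_one_right bot_le (ind_le_one _)
      _ = ENNReal.ofReal (isingTwoPoint G K β 0 .free y (θ y)) * currentZ G Λ β (edgesIn G K) ∅ :=
          currentZ_edgesIn_pair_eq hβ hK hyK hθyK
      _ ≤ ENNReal.ofReal (isingTwoPoint G Λ β 0 .free y (θ y)) * currentZ G Λ β (edgesIn G K) ∅ :=
          mul_le_mul_left (ENNReal.ofReal_le_ofReal (twoPoint_volume_mono hβ hK hyK hθyK)) _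
  · have h1 : ∀ n, ind (h.ConnFix (h.fold n) y) = 1 := fun n => ind_of_true (h.connFix_of_fixed _ hyΛ hfix)
    simp_rw [h1, mul_one]
    rw [hfix, isingTwoPoint_self, ENNReal.ofReal_one, one_mul]
    unfold currentZ
    exact le_rfl

/-- **The `𝒞_n(0)`-term of Lemma 2.5** (Duminil-Copin–Panis 2025, proof of Lemma 2.5, (2.23) and the Griffiths
step): for `S ⊆ Λ` symmetric without fixed vertices with `o, x ∈ S`, `y ∉ S` (`y ∈ Λ` in `H₋ ∪ Fix`),
`Z^{{o,x}}[𝒞_n(o) = S, y ↔ ℍ] ≤ ⟨σ_yσ_{θy}⟩_Λ · Z^{{o,x}}[𝒞_n(o) = S]`. [cite: DuminilCopinPanis2025LowerBounds, Lemma 2.5 (proof, eq. (2.23))] -/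
theorem tsum_cset_connFix_le {β : ℝ} (hβ : 0 ≤ β) {S : Finset V} (hS : S ⊆ Λ) (hsymm : h.Symm S)
    (hnofix : ∀ v ∈ S, θ v ≠ v) {o x y : V} (ho : o ∈ Hm) (hoS : o ∈ S) (hxS : x ∈ S) (hyΛ : y ∈ Λ) (hyS : y ∉ S)
    (hy' : y ∈ Hm ∨ θ y = y) :
    ∑' n, ind (csources G Λ n = {o} ∆ {x} ∧ CSupp G Λ (edgesIn G Λ) n) * cweight G Λ β n *
        (ind (h.cset n o = S) * ind (h.ConnFix (h.fold n) y)) ≤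
      ENNReal.ofReal (isingTwoPoint G Λ β 0 .free y (θ y)) *
        ∑' n, ind (csources G Λ n = {o} ∆ {x} ∧ CSupp G Λ (edgesIn G Λ) n) * cweight G Λ β n * ind (h.cset n o = S) := by
  classical
  have hsymm' : h.Symm (Λ \ S) := h.symm_sdiff hsymm
  have hyK : y ∈ Λ \ S := mem_sdiff.2 ⟨hyΛ, hyS⟩
  have hA : ({o} : Finset V) ∆ {x} ⊆ S := fun v hv => by
    rw [mem_symmDiff, mem_singleton, mem_singleton] at hv
    rcases hv with ⟨rfl, -⟩ | ⟨rfl, -⟩ <;> assumption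
  -- the characterisations across the cut
  have hchar1 : ∀ n, ind (h.cset n o = S) * ind (h.ConnFix (h.fold n) y) =
      ind (CSupp G Λ (edgesIn G S ∪ edgesIn G (Λ \ S)) n) *
        (ind (h.cset (crestr G Λ (edgesIn G S) n) o = S) *
          ind (h.ConnFix (h.fold (crestr G Λ (edgesIn G (Λ \ S)) n)) y)) := by
    intro n
    rw [ind_congr (h.cset_eq_iff ho hsymm hnofix hoS), ind_and, mul_assoc]
    by_cases hcut : CSupp G Λ (edgesIn G S ∪ edgesIn G (Λ \ S)) n
    · rw [ind_of_true hcut, one_mul, one_mul,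
        ind_congr (h.connFix_iff_connFix_crestr hsymm' (csupp_cut_comm hS hcut) hyK)]
    · rw [ind_of_false hcut, zero_mul, zero_mul]
  have hchar2 : ∀ n, ind (h.cset n o = S) =
      ind (CSupp G Λ (edgesIn G S ∪ edgesIn G (Λ \ S)) n) *
        (ind (h.cset (crestr G Λ (edgesIn G S) n) o = S) * (fun _ => (1 : ℝ≥0∞)) (crestr G Λ (edgesIn G (Λ \ S)) n)) := by
    intro n
    rw [ind_congr (h.cset_eq_iff ho hsymm hnofix hoS), ind_and, mul_one]
  simp_rw [hchar1]
  rw [tsum_cut_factor β hA (fun m => ind (h.cset m o = S)) (fun m => ind (h.ConnFix (h.fold m) y))]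
  have hZ2 : (∑' n, ind (csources G Λ n = {o} ∆ {x} ∧ CSupp G Λ (edgesIn G Λ) n) * cweight G Λ β n *
      ind (h.cset n o = S)) = (∑' n₁, ind (csources G Λ n₁ = {o} ∆ {x} ∧ CSupp G Λ (edgesIn G S) n₁) *
        cweight G Λ β n₁ * ind (h.cset n₁ o = S)) * currentZ G Λ β (edgesIn G (Λ \ S)) ∅ := by
    rw [show (∑' n, ind (csources G Λ n = {o} ∆ {x} ∧ CSupp G Λ (edgesIn G Λ) n) * cweight G Λ β n *
        ind (h.cset n o = S)) = ∑' n, ind (csources G Λ n = {o} ∆ {x} ∧ CSupp G Λ (edgesIn G Λ) n) * cweight G Λ β n *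
        (ind (CSupp G Λ (edgesIn G S ∪ edgesIn G (Λ \ S)) n) *
          (ind (h.cset (crestr G Λ (edgesIn G S) n) o = S) * (fun _ => (1 : ℝ≥0∞)) (crestr G Λ (edgesIn G (Λ \ S)) n)))
        from tsum_congr fun n => by rw [hchar2 n],
      tsum_cut_factor β hA (fun m => ind (h.cset m o = S)) (fun _ => (1 : ℝ≥0∞))]
    unfold currentZ
    simp only [mul_one]
  rw [hZ2, mul_left_comm]
  refine mul_le_mul_right ?_ _
  exact h.tsum_outer_connFix_le hβ sdiff_subset hsymm' hyK hy'

/-! ### Lemma 2.5: assembly -/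

omit h in
/-- Current sums over `ℰ_Λ` are finite (`β ≥ 0`). [folklore] -/
theorem currentZ_edgesIn_self_ne_top {β : ℝ} (hβ : 0 ≤ β) (A : Finset V) :
    currentZ G Λ β (edgesIn G Λ) A ≠ ∞ := by
  rw [currentZ_edgesIn_eq G Λ hβ (Subset.refl Λ)]
  exact ENNReal.ofReal_ne_top

/-- **The un-conditioning step of Lemma 2.5** (Duminil-Copin–Panis 2025, proof of Lemma 2.5, from (2.22) to the
end): for `o, x ∈ H₋` and `y ∈ Λ` in `H₋ ∪ Fix`,
`∑_{∂n={o,x}} w(n) 𝟙[o,x ↮ ℍ, y ↔ ℍ] ≤ ⟨σ_yσ_{θy}⟩_Λ (Z^{{o,x}} - Z^{{o,θx}})` — condition on `𝒞_n(o) = S`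
(`tsum_cset_connFix_le`), re-sum over `S` (at most one value of `𝒞_n(o)`; `𝒞_n(o)` without fixed vertex forces
`o ↮ ℍ`, hence `x ↮ ℍ`), and use `Z^{{o,x}}[x ↮ ℍ] = Z^{{o,x}} - Z^{{o,θx}}`. [cite: DuminilCopinPanis2025LowerBounds, Lemma 2.5 (proof, eqs. (2.22)–(2.23) and the final display)] -/
theorem tsum_pair_event_le {β : ℝ} (hβ : 0 ≤ β) {o x y : V} (ho : o ∈ Hm) (hx : x ∈ Hm) (hyΛ : y ∈ Λ)
    (hy' : y ∈ Hm ∨ θ y = y) :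
    ∑' n, ind (csources G Λ n = {o} ∆ {x} ∧ CSupp G Λ (edgesIn G Λ) n) * cweight G Λ β n *
        ind (¬ h.ConnFix (h.fold n) o ∧ ¬ h.ConnFix (h.fold n) x ∧ h.ConnFix (h.fold n) y) ≤
      ENNReal.ofReal (isingTwoPoint G Λ β 0 .free y (θ y)) *
        (currentZ G Λ β (edgesIn G Λ) ({o} ∆ {x}) - currentZ G Λ β (edgesIn G Λ) ({o} ∆ {θ x})) := by
  classical
  have hoΛ : o ∈ Λ := h.left_subset ho
  have hxΛ : x ∈ Λ := h.left_subset hx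
  set wt : (edgesIn G Λ → ℕ) → ℝ≥0∞ := fun n =>
    ind (csources G Λ n = {o} ∆ {x} ∧ CSupp G Λ (edgesIn G Λ) n) * cweight G Λ β n with hwt
  set Fam : Finset (Finset V) := Λ.powerset.filter fun S =>
    h.Symm S ∧ (∀ v ∈ S, θ v ≠ v) ∧ o ∈ S ∧ x ∈ S ∧ y ∉ S with hFam
  -- Step A: pointwise conditioning on `𝒞_n(o)`
  have hA : ∀ n, wt n * ind (¬ h.ConnFix (h.fold n) o ∧ ¬ h.ConnFix (h.fold n) x ∧ h.ConnFix (h.fold n) y) ≤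
      ∑ S ∈ Fam, wt n * (ind (h.cset n o = S) * ind (h.ConnFix (h.fold n) y)) := by
    intro n
    by_cases hsrc : csources G Λ n = {o} ∆ {x} ∧ CSupp G Λ (edgesIn G Λ) n
    · by_cases hP : ¬ h.ConnFix (h.fold n) o ∧ ¬ h.ConnFix (h.fold n) x ∧ h.ConnFix (h.fold n) y
      · have hmem : h.cset n o ∈ Fam := by
          rw [hFam, mem_filter, mem_powerset]
          refine ⟨h.cset_subset n o, h.symm_cset n o, fun v hv => h.nofix_of_mem_cset hP.1 hv,
            h.mem_cset_self n hoΛ, ?_, fun hyC => ?_⟩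
          · exact (h.mem_cset_iff_cconn ho hxΛ (Or.inl hx)).2 (h.cconn_fold_of_csources_pair ho hx hsrc.1 hP.1)
          · have hc := (h.mem_cset_iff_cconn ho hyΛ hy').1 hyC
            exact hP.1 ((h.connFix_iff_of_cconn hc).2 hP.2.2)
        refine le_trans ?_ (single_le_sum (f := fun S => wt n * (ind (h.cset n o = S) * ind (h.ConnFix (h.fold n) y)))
          (fun S _ => bot_le) hmem)
        simp only
        rw [ind_of_true trivial, ind_of_true hP.2.2, one_mul, mul_one]
        exact mul_le_of_le_one_right bot_le (ind_le_one _)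
      · rw [ind_of_false hP, mul_zero]; exact bot_le
    · have h0 : wt n = 0 := by rw [hwt]; simp only; rw [ind_of_false hsrc, zero_mul]
      rw [h0, zero_mul]; exact bot_le
  -- Step B: sum over `S`, use the `𝒞_n(o)`-bound termwise
  have hB : ∑' n, wt n * ind (¬ h.ConnFix (h.fold n) o ∧ ¬ h.ConnFix (h.fold n) x ∧ h.ConnFix (h.fold n) y) ≤
      ENNReal.ofReal (isingTwoPoint G Λ β 0 .free y (θ y)) * ∑' n, wt n * ∑ S ∈ Fam, ind (h.cset n o = S) := by
    calc ∑' n, wt n * ind (¬ h.ConnFix (h.fold n) o ∧ ¬ h.ConnFix (h.fold n) x ∧ h.ConnFix (h.fold n) y)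
        ≤ ∑' n, ∑ S ∈ Fam, wt n * (ind (h.cset n o = S) * ind (h.ConnFix (h.fold n) y)) := ENNReal.tsum_le_tsum hA
      _ = ∑ S ∈ Fam, ∑' n, wt n * (ind (h.cset n o = S) * ind (h.ConnFix (h.fold n) y)) :=
          Summable.tsum_finsetSum (fun _ _ => ENNReal.summable)
      _ ≤ ∑ S ∈ Fam, ENNReal.ofReal (isingTwoPoint G Λ β 0 .free y (θ y)) * ∑' n, wt n * ind (h.cset n o = S) := by
          refine sum_le_sum fun S hS => ?_
          rw [hFam, mem_filter, mem_powerset] at hS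
          obtain ⟨hSΛ, hsymm, hnofix, hoS, hxS, hyS⟩ := hS
          exact h.tsum_cset_connFix_le hβ hSΛ hsymm hnofix ho hoS hxS hyΛ hyS hy'
      _ = ENNReal.ofReal (isingTwoPoint G Λ β 0 .free y (θ y)) * ∑' n, wt n * ∑ S ∈ Fam, ind (h.cset n o = S) := by
          rw [← mul_sum, ← Summable.tsum_finsetSum (fun _ _ => ENNReal.summable)]
          congr 1
          refine tsum_congr fun n => ?_
          rw [mul_sum]
  -- Step C: at most one `S`, and it forces `x ↮ ℍ`
  have hC : ∀ n, wt n * ∑ S ∈ Fam, ind (h.cset n o = S) ≤ wt n * ind (¬ h.ConnFix (h.fold n) x) := by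
    intro n
    by_cases hsrc : csources G Λ n = {o} ∆ {x} ∧ CSupp G Λ (edgesIn G Λ) n
    · refine mul_le_mul_right ?_ _
      by_cases hmem : h.cset n o ∈ Fam
      · rw [sum_eq_single (h.cset n o), ind_of_true rfl, ind_of_true]
        · rw [hFam, mem_filter] at hmem
          exact h.not_connFix_x_of_not_connFix_o ho hx hsrc.1 (h.not_connFix_of_cset_nofix hmem.2.2.1)
        · intro S _ hS; exact ind_of_false fun h' => hS h'.symm
        · intro hn; exact absurd hmem hn
      · rw [sum_eq_zero fun S hS => ind_of_false (show ¬ (h.cset n o = S) from fun h' => hmem (h' ▸ hS))]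
        exact bot_le
    · have h0 : wt n = 0 := by rw [hwt]; simp only; rw [ind_of_false hsrc, zero_mul]
      rw [h0, zero_mul, zero_mul]
  -- Step D: `Z^{{o,x}}[x ↮ ℍ] = Z^{{o,x}} - Z^{{o,θx}}`
  have hE : ∀ e ∈ edgesIn G Λ, e ∈ edgesIn G Λ ↔ Sym2.map θ e ∈ edgesIn G Λ := fun e he =>
    ⟨fun he' => h.map_mem_edgesIn he', fun _ => he⟩
  have hD : ∑' n, wt n * ind (¬ h.ConnFix (h.fold n) x) =
      currentZ G Λ β (edgesIn G Λ) ({o} ∆ {x}) - currentZ G Λ β (edgesIn G Λ) ({o} ∆ {θ x}) :=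
    ENNReal.eq_sub_of_add_eq (currentZ_edgesIn_self_ne_top hβ _) (h.tsum_not_connFix_add_currentZ hβ hE ho hx)
  calc ∑' n, wt n * ind (¬ h.ConnFix (h.fold n) o ∧ ¬ h.ConnFix (h.fold n) x ∧ h.ConnFix (h.fold n) y)
      ≤ ENNReal.ofReal (isingTwoPoint G Λ β 0 .free y (θ y)) * ∑' n, wt n * ∑ S ∈ Fam, ind (h.cset n o = S) := hB
    _ ≤ ENNReal.ofReal (isingTwoPoint G Λ β 0 .free y (θ y)) * ∑' n, wt n * ind (¬ h.ConnFix (h.fold n) x) :=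
        mul_le_mul_right (ENNReal.tsum_le_tsum hC) _
    _ = _ := by rw [hD]

open Classical in
/-- **Lemma 2.5 of Duminil-Copin–Panis 2025 (per pair, current form).** For a fold datum, `β ≥ 0`, a
candidate region `B ⊆ Λ` inside `H₋ ∪ Fix` (the box), `o, x ∈ B ∩ H₋` and `y ∈ Λ` in `H₋ ∪ Fix`, with the
random volume `W(n) = {v ∈ B : v ↮_{ℳ_n} ℍ}` (the source's `𝒮¹_n`):
`∑_{∂n = ∅} w(n) 𝟙[o, x ∈ W(n), y ↔ ℍ] ⟨σ_oσ_x⟩^∅_{W(n)} ≤ (Z^{{o,x}} - Z^{{o,θx}}) · ⟨σ_yσ_{θy}⟩^∅_Λ`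
— the printed "`𝐄^∅[𝟙_{0,x ∈ 𝒮¹} 𝟙_{y ↔ ℍ} ⟨σ₀σ_x⟩_{𝒮¹}] ≤ (⟨σ₀σ_x⟩ - ⟨σ₀σ_{𝓡x}⟩)⟨σ_yσ_{𝓡y}⟩`" multiplied by
`Z^∅`. Proof as printed: Griffiths (`𝒮¹ ⊆ 𝒢_n`), the Markov step on `𝒢_n` (`tsum_gset_markov`), conditioning
on `𝒞_n(0)` with the outer switching (`tsum_pair_event_le`). [cite: DuminilCopinPanis2025LowerBounds, Lemma 2.5] -/
theorem lemma25 {β : ℝ} (hβ : 0 ≤ β) {B : Finset V} (hB : B ⊆ Λ) (hBfix : ∀ v ∈ B, v ∈ Hm ∨ θ v = v)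
    {o x y : V} (ho : o ∈ Hm) (hx : x ∈ Hm) (hoB : o ∈ B) (hxB : x ∈ B) (hyΛ : y ∈ Λ) (hy' : y ∈ Hm ∨ θ y = y) :
    ∑' n, ind (csources G Λ n = ∅ ∧ CSupp G Λ (edgesIn G Λ) n) * cweight G Λ β n *
        (ind (¬ h.ConnFix (h.fold n) o ∧ ¬ h.ConnFix (h.fold n) x ∧ h.ConnFix (h.fold n) y) *
          ENNReal.ofReal (isingTwoPoint G (B.filter fun v => ¬ h.ConnFix (h.fold n) v) β 0 .free o x)) ≤
      (currentZ G Λ β (edgesIn G Λ) ({o} ∆ {x}) - currentZ G Λ β (edgesIn G Λ) ({o} ∆ {θ x})) *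
        ENNReal.ofReal (isingTwoPoint G Λ β 0 .free y (θ y)) := by
  classical
  -- Griffiths: `W(n) ⊆ 𝒢_n`
  have hS1 : ∀ n, ind (¬ h.ConnFix (h.fold n) o ∧ ¬ h.ConnFix (h.fold n) x ∧ h.ConnFix (h.fold n) y) *
      ENNReal.ofReal (isingTwoPoint G (B.filter fun v => ¬ h.ConnFix (h.fold n) v) β 0 .free o x) ≤
      ind (¬ h.ConnFix (h.fold n) o ∧ ¬ h.ConnFix (h.fold n) x ∧ h.ConnFix (h.fold n) y) *
        ENNReal.ofReal (isingTwoPoint G (h.gset n) β 0 .free o x) := by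
    intro n
    by_cases hP : ¬ h.ConnFix (h.fold n) o ∧ ¬ h.ConnFix (h.fold n) x ∧ h.ConnFix (h.fold n) y
    · refine mul_le_mul_right (ENNReal.ofReal_le_ofReal (twoPoint_volume_mono hβ ?_ ?_ ?_)) _
      · intro v hv
        obtain ⟨hvB, hvc⟩ := mem_filter.1 hv
        exact (h.mem_gset_iff_not_connFix (hB hvB) (hBfix v hvB)).2 hvc
      · exact mem_filter.2 ⟨hoB, hP.1⟩
      · exact mem_filter.2 ⟨hxB, hP.2.1⟩
    · rw [ind_of_false hP, zero_mul, zero_mul]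
  calc ∑' n, ind (csources G Λ n = ∅ ∧ CSupp G Λ (edgesIn G Λ) n) * cweight G Λ β n *
        (ind (¬ h.ConnFix (h.fold n) o ∧ ¬ h.ConnFix (h.fold n) x ∧ h.ConnFix (h.fold n) y) *
          ENNReal.ofReal (isingTwoPoint G (B.filter fun v => ¬ h.ConnFix (h.fold n) v) β 0 .free o x))
      ≤ ∑' n, ind (csources G Λ n = ∅ ∧ CSupp G Λ (edgesIn G Λ) n) * cweight G Λ β n *
          (ind (¬ h.ConnFix (h.fold n) o ∧ ¬ h.ConnFix (h.fold n) x ∧ h.ConnFix (h.fold n) y) *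
            ENNReal.ofReal (isingTwoPoint G (h.gset n) β 0 .free o x)) :=
        ENNReal.tsum_le_tsum fun n => mul_le_mul_right (hS1 n) _
    _ = ∑' n, ind (csources G Λ n = {o} ∆ {x} ∧ CSupp G Λ (edgesIn G Λ) n) * cweight G Λ β n *
          ind (¬ h.ConnFix (h.fold n) o ∧ ¬ h.ConnFix (h.fold n) x ∧ h.ConnFix (h.fold n) y) :=
        h.tsum_gset_markov hβ ho hx hyΛ hy'
    _ ≤ ENNReal.ofReal (isingTwoPoint G Λ β 0 .free y (θ y)) *
          (currentZ G Λ β (edgesIn G Λ) ({o} ∆ {x}) - currentZ G Λ β (edgesIn G Λ) ({o} ∆ {θ x})) :=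
        h.tsum_pair_event_le hβ ho hx hyΛ hy'
    _ = _ := mul_comm _ _

end IsFoldable

end Literature.Probability.LatticeModels
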